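import Mathlib
import HarnessLib

/-!
# Free canonical gas at `β·t = 8` — the arc integral `∫_{−π}^{π} e^{−(1−cos φ)s} dφ ≤ π²/√(1+s)` (why no saddle point is needed)

Helper file for route `TcThermcert1` (crux K1′ `ThermalStiffnessCeilingU8b8_le_7o44`, item `stmt-Ventures-24560`), crux idea
`free-canonical-b8-rung`. The scheme divides a fugacity-circle integral dominated by the Gaussian factor `e^{−(1−cos φ)σ²}` (S2,
`Theorems/TcThermcert1FreeCanonicalTwoFugacityDomination.lean`) by the sector weight at a mode, `≥ 3/(4(4σ+3))` (S3,
`Theorems/TcThermcert1FreeCanonicalPoissonBinomialMoments.lean`). The two variance factors cancel — uniformly in the volume — because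

  `∫_{−π}^{π} e^{−(1 − cos φ) s} dφ ≤ π² / √(1 + s)`   for every `s ≥ 0`

(Jordan's inequality `1 − cos φ ≥ 2φ²/π²` on `[−π, π]` and the Gaussian integral for `s ≥ 1`; the trivial bound `2π` for `s ≤ 1`), so
`(4(4σ+3)/3) · (2π)⁻¹ ∫ e^{−(1−cos φ)σ²} dφ ≤ (4(4σ+3)/3)·(π/2)/√(1+σ²) ≤ 14π` for all `σ ≥ 0`: an `O(1)` bracket with no local limit
theorem and no saddle-point analysis (the card's "variance-only" mechanism, made quantitative).

HONEST LABEL: elementary real analysis; a step of a RUNG (`U = 0`, BC5-type witness for the C8 bet), reach at `U = 8` ZERO; decides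
nothing about K1/K1′/`T_c`; superconductivity in the Hubbard model is NOT proved or advanced by this file beyond the rung.
-/

noncomputable section

namespace Summit.Ventures.CertifiedManyBodySolver.Theorems.TcThermcert1.FreeCanonicalB8

open Real MeasureTheory intervalIntegral Set

/-- **Jordan-type lower bound** `2φ²/π² ≤ 1 − cos φ` for `|φ| ≤ π`. -/
theorem two_mul_sq_div_pi_sq_le_one_sub_cos {φ : ℝ} (hφ : |φ| ≤ π) : 2 * φ ^ 2 / π ^ 2 ≤ 1 - Real.cos φ := by
  -- `1 − cos φ = 2 sin²(φ/2)` and `sin²(φ/2) = sin²(|φ|/2) ≥ (2/π · |φ|/2)² = φ²/π²`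
  have hcos : 1 - Real.cos φ = 2 * Real.sin (φ / 2) ^ 2 := by
    have h := Real.cos_sq (φ / 2)  -- cos (φ/2)^2 = 1/2 + cos (2 * (φ/2)) / 2
    rw [show 2 * (φ / 2) = φ by ring] at h
    have h2 := Real.sin_sq_add_cos_sq (φ / 2)
    linarith
  have hsq : Real.sin (φ / 2) ^ 2 = Real.sin (|φ| / 2) ^ 2 := by
    rcases le_or_gt 0 φ with h | h
    · rw [abs_of_nonneg h]
    · rw [abs_of_neg h, neg_div, Real.sin_neg, neg_sq]
  have hy0 : 0 ≤ |φ| / 2 := by positivity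
  have hy1 : |φ| / 2 ≤ π / 2 := by linarith
  have hj := Real.mul_le_sin hy0 hy1   -- 2/π * (|φ|/2) ≤ sin (|φ|/2)
  have hj0 : 0 ≤ 2 / π * (|φ| / 2) := by positivity
  have hj2 : (2 / π * (|φ| / 2)) ^ 2 ≤ Real.sin (|φ| / 2) ^ 2 := pow_le_pow_left₀ hj0 hj 2
  have hπ : 0 < π := Real.pi_pos
  have hid : (2 / π * (|φ| / 2)) ^ 2 = φ ^ 2 / π ^ 2 := by
    rw [show 2 / π * (|φ| / 2) = |φ| / π by ring, div_pow, sq_abs]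
  rw [hcos, hsq]
  rw [hid] at hj2
  have : 2 * φ ^ 2 / π ^ 2 = 2 * (φ ^ 2 / π ^ 2) := by ring
  rw [this]
  linarith

/-- Pointwise: on `[−π, π]`, `e^{−(1−cos φ)s} ≤ e^{−(2s/π²) φ²}` for `s ≥ 0`. -/
theorem exp_neg_one_sub_cos_mul_le {φ s : ℝ} (hφ : |φ| ≤ π) (hs : 0 ≤ s) :
    Real.exp (-((1 - Real.cos φ) * s)) ≤ Real.exp (-(2 * s / π ^ 2) * φ ^ 2) := by
  rw [Real.exp_le_exp]
  have h := two_mul_sq_div_pi_sq_le_one_sub_cos hφ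
  have h2 : 2 * s / π ^ 2 * φ ^ 2 = (2 * φ ^ 2 / π ^ 2) * s := by ring
  rw [neg_mul, h2, neg_le_neg_iff]
  exact mul_le_mul_of_nonneg_right h hs

/-- **The arc integral bound.** For every `s ≥ 0`: `∫_{−π}^{π} e^{−(1−cos φ)s} dφ ≤ π²/√(1+s)`. -/
theorem integral_exp_neg_one_sub_cos_mul_le {s : ℝ} (hs : 0 ≤ s) :
    ∫ φ in (-π)..π, Real.exp (-((1 - Real.cos φ) * s)) ≤ π ^ 2 / Real.sqrt (1 + s) := by
  have hπ : 0 < π := Real.pi_pos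
  have hπ3 : 3 < π := Real.pi_gt_three
  have hcont : Continuous fun φ : ℝ => Real.exp (-((1 - Real.cos φ) * s)) := by fun_prop
  rcases le_or_gt s 1 with hs1 | hs1
  · -- `s ≤ 1`: the integrand is `≤ 1`, the integral `≤ 2π ≤ π²/√2 ≤ π²/√(1+s)`
    have h1 : ∫ φ in (-π)..π, Real.exp (-((1 - Real.cos φ) * s)) ≤ ∫ φ in (-π)..π, (1 : ℝ) := by
      refine intervalIntegral.integral_mono_on (by linarith) (hcont.intervalIntegrable _ _) (by simp) fun φ _ => ?_
      rw [Real.exp_le_one_iff, neg_nonpos]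
      exact mul_nonneg (by linarith [Real.cos_le_one φ]) hs
    rw [intervalIntegral.integral_const, smul_eq_mul, mul_one] at h1
    have hsqrt : Real.sqrt (1 + s) ≤ Real.sqrt 2 := Real.sqrt_le_sqrt (by linarith)
    have hsqrt2 : Real.sqrt 2 < 3 / 2 := by
      rw [show (3 / 2 : ℝ) = Real.sqrt ((3 / 2) ^ 2) by rw [Real.sqrt_sq (by norm_num)]]
      exact Real.sqrt_lt_sqrt (by norm_num) (by norm_num)
    have hpos : 0 < Real.sqrt (1 + s) := Real.sqrt_pos.2 (by linarith)
    rw [le_div_iff₀ hpos]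
    nlinarith
  · -- `s ≥ 1`: Jordan + Gaussian integral
    set b : ℝ := 2 * s / π ^ 2 with hb
    have hb0 : 0 < b := by positivity
    have h1 : ∫ φ in (-π)..π, Real.exp (-((1 - Real.cos φ) * s)) ≤ ∫ φ in (-π)..π, Real.exp (-b * φ ^ 2) := by
      refine intervalIntegral.integral_mono_on (by linarith) (hcont.intervalIntegrable _ _) ((by fun_prop : Continuous fun φ : ℝ =>
        Real.exp (-b * φ ^ 2)).intervalIntegrable _ _) fun φ hφ => ?_
      exact exp_neg_one_sub_cos_mul_le (abs_le.2 ⟨by linarith [hφ.1], hφ.2⟩) hs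
    have h2 : ∫ φ in (-π)..π, Real.exp (-b * φ ^ 2) ≤ ∫ φ : ℝ, Real.exp (-b * φ ^ 2) := by
      rw [intervalIntegral.integral_of_le (by linarith)]
      exact setIntegral_le_integral (integrable_exp_neg_mul_sq hb0) (Filter.Eventually.of_forall fun φ => (Real.exp_pos _).le)
    rw [integral_gaussian] at h2
    have h3 : Real.sqrt (π / b) ≤ π ^ 2 / Real.sqrt (1 + s) := by
      have hpos : 0 < Real.sqrt (1 + s) := Real.sqrt_pos.2 (by linarith)
      rw [le_div_iff₀ hpos, ← Real.sqrt_mul (by positivity)]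
      calc Real.sqrt (π / b * (1 + s)) ≤ Real.sqrt ((π ^ 2) ^ 2) := by
            refine Real.sqrt_le_sqrt ?_
            rw [hb, div_div_eq_mul_div]
            rw [div_mul_eq_mul_div, div_le_iff₀ (by positivity)]
            have hkey : 1 + s ≤ 2 * π * s := by nlinarith
            calc π * π ^ 2 * (1 + s) ≤ π * π ^ 2 * (2 * π * s) := mul_le_mul_of_nonneg_left hkey (by positivity)
              _ = (π ^ 2) ^ 2 * (2 * s) := by ring
        _ = π ^ 2 := Real.sqrt_sq (by positivity)
    exact h1.trans (h2.trans h3)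

/-- **The bracket is O(1).** For every `σ ≥ 0`:
`(4(4σ+3)/3) · ∫_{−π}^{π} e^{−(1−cos φ)σ²} dφ ≤ 28π²` — the product of the mode-anticoncentration loss
(`mode_weight_anticoncentration`) and the Gaussian-dominated arc integral is bounded uniformly in the variance. -/
theorem modeLoss_mul_arcIntegral_le {σ : ℝ} (hσ : 0 ≤ σ) :
    4 * (4 * σ + 3) / 3 * ∫ φ in (-π)..π, Real.exp (-((1 - Real.cos φ) * σ ^ 2)) ≤ 28 * π ^ 2 := by
  have hπ : 0 < π := Real.pi_pos
  have hI := integral_exp_neg_one_sub_cos_mul_le (sq_nonneg σ)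
  have hpos : 0 < Real.sqrt (1 + σ ^ 2) := Real.sqrt_pos.2 (by positivity)
  -- `4σ + 3 ≤ 7 √(1+σ²)` since `σ ≤ √(1+σ²)` and `1 ≤ √(1+σ²)`
  have hσle : σ ≤ Real.sqrt (1 + σ ^ 2) :=
    calc σ = Real.sqrt (σ ^ 2) := (Real.sqrt_sq hσ).symm
      _ ≤ Real.sqrt (1 + σ ^ 2) := Real.sqrt_le_sqrt (by linarith)
  have h1le : 1 ≤ Real.sqrt (1 + σ ^ 2) :=
    calc (1 : ℝ) = Real.sqrt 1 := Real.sqrt_one.symm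
      _ ≤ Real.sqrt (1 + σ ^ 2) := Real.sqrt_le_sqrt (by nlinarith)
  have hnum : 4 * (4 * σ + 3) / 3 ≤ 28 / 3 * Real.sqrt (1 + σ ^ 2) := by nlinarith
  have hInn : 0 ≤ ∫ φ in (-π)..π, Real.exp (-((1 - Real.cos φ) * σ ^ 2)) :=
    intervalIntegral.integral_nonneg (by linarith) fun φ _ => (Real.exp_pos _).le
  calc 4 * (4 * σ + 3) / 3 * ∫ φ in (-π)..π, Real.exp (-((1 - Real.cos φ) * σ ^ 2))
      ≤ (28 / 3 * Real.sqrt (1 + σ ^ 2)) * (π ^ 2 / Real.sqrt (1 + σ ^ 2)) :=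
        mul_le_mul hnum hI hInn (by positivity)
    _ = 28 / 3 * π ^ 2 := by field_simp
    _ ≤ 28 * π ^ 2 := by nlinarith [mul_pos hπ hπ]

end Summit.Ventures.CertifiedManyBodySolver.Theorems.TcThermcert1.FreeCanonicalB8

end
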